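/-
Copyright (c) 2026 the pub-hodgecm-mathlib formalisation cell (harness21).  Prover seat hodgecm-mathlib-K2Liu-p10 (g3), Track B «K2-LIT»,
#184♮ = hLiu418 = `stmt-HodgeConjecture-24832`; LEAD F0P6-plan (g13) RULING «M-157j» (1): G5-a sub-organ (α) (the middle cell of the
constant term), file α3-1 — PRELIMINARIES FOR THE MIDDLE CELL: orbit `L¹` bounds for stabiliser weights, conjugation automorphisms of `N_Δ(𝔸)`,
Fubini for series on a set of cosets, regrouping along a disjoint union.  THEOREMS ONLY (no `def`, no `instance`, no named-fact hypothesis, no `sorry`).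
-/
import Summits.HodgeConjecture.HodgeConjecture.Theorems.K2LiuSiegelMiddleOrbitUnfold        -- α2a: one orbit = one weighted integral
import Summits.HodgeConjecture.HodgeConjecture.Theorems.K2LiuSiegelRationalLeviDecomposition  -- α2c (for the `Λ`-conjugation users)
import HarnessLib

/-!
# Crux `HLiu418`, ROAD Φ, (α) file α3-1: PRELIMINARIES FOR THE MIDDLE CELL OF THE CONSTANT TERM (any `n`)

Cell `hodgecm-mathlib`, crux item hLiu418 = `stmt-HodgeConjecture-24832` (helper lane, count-neutral).  Four devices used by α3-2
`K2LiuConstantTermMiddleCellGL2` (the middle cell as a `GL₂` Borel Eisenstein sum), all for general `n`: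
* **`lintegral_orbit_ne_top`** — the orbit piece of the absolute-convergence hypothesis (H) bounds `∫⁻ ‖f(γ₀ u h)‖ₑ β₁(u) dνN` for EVERY
  `Stab(γ₀)`-covering weight `β₁` (Tonelli unfolding ★ `lintegral_mul_eq_lintegral_tsum_mul` over the orbit as a section of `Stab(γ₀)∖N_Δ(L⁺)`, exactly as
  inside α2a `tsum_orbit_eq_integral_wt_smul`; ★ `apply_out_orbit`, ★ `apply_translate_subgroup_mul`);
* `exists_conj_mulEquiv` — conjugation by an element of `H(𝔸)` normalising `N_Δ(𝔸)` (e.g. `Λ(x)`, α2c `conj_levi_mem_unipDelta`) as a `MulEquiv` of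
  `N_Δ(𝔸)` together with its values (kept abstract downstream: no unfolding of `ι`, `Λ`);
* `integral_wt_smul_tsum_subtype_eq_tsum`, `summable_integral_wt_smul` — Fubini for series under (H) on ANY set of cosets `R ⊆ P_Δ(L⁺)∖H(L⁺)`:
  `∫ β(u) • Σ_{q ∈ R} f(γ_q u h) dνN = Σ_{q ∈ R} ∫ β(u) • f(γ_q u h) dνN`, and absolute summability of the coset integrals (★ `…RestOrbits` Steps 1–2, `S = 0`);
* `hasSum_tsum_subtype_of_eq_iUnion` — regrouping an absolutely convergent sum along a disjoint union `R = ⨆_i O(i)` (Mathlib `Set.unionEqSigmaOfDisjoint`,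
  `Summable.tsum_sigma'`).
Sources: [MoeglinWaldspurger1995, II.1.7]; [KudlaRallis1994, §2]; [Garrett2018, §3.10]; [CogdellAnalyticTheory2004, §2.3].
HONEST LABEL.  Helper lemmas, count-neutral; `HC_CM` is proved only modulo the 7 printed citations (2 remaining named inputs:
hLiu418 = `stmt-HodgeConjecture-24832`, h413 = `stmt-HodgeConjecture-24833`) until rung 0 closes.
-/

set_option autoImplicit false
set_option linter.dupNamespace false -- the mandated namespace repeats `HodgeConjecture.HodgeConjecture`

noncomputable section

open scoped Matrix ENNReal NNReal
open NumberField IsDedekindDomain MeasureTheory MeasureTheory.Measure Filter Set Function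
open Literature.NumberTheory.Automorphic Literature.NumberTheory.Automorphic.UnitaryGroup Literature.NumberTheory.GaloisRepresentations
open Literature.NumberTheory.GelbartRogawski1991 Literature.NumberTheory.GelbartRogawski1991.GRConstruction
open Literature.NumberTheory.GelbartRogawski1991.AdaptedBlocks
open Literature.NumberTheory.K2Lit.SiegelDoubled Literature.MeasureTheory.Group
open UnitaryDualPair

namespace Summit.HodgeConjecture.HodgeConjecture.Cruxes.HLiu418.K2LiuConstantTermMiddleCellPrelims

open K2LiuUnipotentCoveringWeight K2LiuConstantTermBigCellUnfold K2LiuSiegelDoubledUnfold K2LiuConstantTermDelta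
  K2LiuSiegelEisensteinCoeffCells K2LiuSiegelEisensteinCoeffOrbitSum K2LiuSiegelBruhatMiddleCellDelta
  K2LiuSiegelEisensteinCoeffMiddleOrbits K2LiuSiegelMiddleOrbitUnfold

variable {L : Type} [Field L] [NumberField L] [IsCMField L]

/-! ## 1. The `L¹` bound of one orbit against a stabiliser weight -/

section General

variable {N M n : ℕ} {e : Fin N × Fin M ≃ Fin n}
  {dV : Fin N → L} {hdV : ∀ i, IsCMField.complexConj L (dV i) = dV i}
  {dW : Fin M → L} {hdW : ∀ i, IsCMField.complexConj L (dW i) = dW i}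
variable [MeasurableSpace (unipDelta L e dV hdV dW hdW)] [BorelSpace (unipDelta L e dV hdV dW hdW)]

/-- **THE ORBIT PIECE OF (H) BOUNDS `∫⁻ ‖f(γ₀ u h)‖ₑ β₁ dνN` FOR EVERY `Stab(γ₀)`-WEIGHT `β₁`.**  `νN` left-invariant, `β` an `N_Δ(L⁺)`-covering weight,
`f` a continuous Siegel section, `γ₀ ∈ H(L⁺)`, `Γ' = Stab(γ₀)` (membership law), `β₁` any `Γ'`-covering weight; if
`∫⁻ (Σ_{q ∈ O(γ₀)} ‖f(γ_q u h)‖ₑ) β(u) dνN < ∞` then `∫⁻ ‖f(γ₀ u h)‖ₑ β₁(u) dνN < ∞` — Tonelli unfolding over the orbit as a section of `Γ'∖N_Δ(L⁺)`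
(★ `lintegral_mul_eq_lintegral_tsum_mul`, ★ `apply_out_orbit`, ★ `apply_translate_subgroup_mul`). [cite: MoeglinWaldspurger1995, II.1.7] [cite: CogdellAnalyticTheory2004, §2.3] -/
theorem lintegral_orbit_ne_top (νN : Measure (unipDelta L e dV hdV dW hdW)) [νN.IsMulLeftInvariant]
    {β : unipDelta L e dV hdV dW hdW → ℝ≥0∞} (hβ : IsCoveringWeight (unipDeltaRat L e dV hdV dW hdW) β)
    {χ : HeckeCharacter L} {s : ℂ} {f : HA L e dV hdV dW hdW → ℂ} (hf : IsSiegelDeltaSection L e dV hdV dW hdW χ s f) (hfc : Continuous f)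
    (γ₀ : ratH L e dV hdV dW hdW) (h : HA L e dV hdV dW hdW)
    (Γ' : Subgroup (unipDelta L e dV hdV dW hdW))
    (hΓ' : ∀ u : unipDelta L e dV hdV dW hdW, u ∈ Γ' ↔ (u : HA L e dV hdV dW hdW) ∈ ratH L e dV hdV dW hdW ∧
      IsSiegelDelta L e dV hdV dW hdW ((γ₀ : HA L e dV hdV dW hdW) * (u : HA L e dV hdV dW hdW) * ((γ₀ : HA L e dV hdV dW hdW))⁻¹))
    {β₁ : unipDelta L e dV hdV dW hdW → ℝ≥0∞} (hβ₁ : IsCoveringWeight Γ' β₁)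
    (hO : ∫⁻ u, (∑' q : ↥(Set.range (fun ν : unipDeltaRat L e dV hdV dW hdW =>
        (Quotient.mk (MulAction.orbitRel (siegelDeltaRat L e dV hdV dW hdW) (ratH L e dV hdV dW hdW))
          (γ₀ * ⟨((ν : unipDelta L e dV hdV dW hdW) : HA L e dV hdV dW hdW), coe_mem_ratH ν⟩)))),
        ‖f (((Quotient.out q.1 : ratH L e dV hdV dW hdW) : HA L e dV hdV dW hdW) * ((u : HA L e dV hdV dW hdW) * h))‖ₑ) * β u ∂νN ≠ ∞) :
    ∫⁻ u, ‖f ((γ₀ : HA L e dV hdV dW hdW) * (u : HA L e dV hdV dW hdW) * h)‖ₑ * β₁ u ∂νN ≠ ∞ := by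
  classical
  haveI : Countable (unipDeltaRat L e dV hdV dW hdW) := countable_unipDeltaRat L e dV hdV dW hdW
  haveI : Countable (ratH L e dV hdV dW hdW) := countable_ratH L e dV hdV dW hdW
  haveI : Countable (SiegelDeltaQuot L e dV hdV dW hdW) := by unfold SiegelDeltaQuot; exact inferInstance
  haveI : MeasurableConstSMul (unipDelta L e dV hdV dW hdW) (unipDelta L e dV hdV dW hdW) := ⟨fun g => measurable_const_mul g⟩
  haveI : SMulInvariantMeasure (unipDelta L e dV hdV dW hdW) (unipDelta L e dV hdV dW hdW) νN :=
    ⟨fun g t _ht => by rw [show (fun x : unipDelta L e dV hdV dW hdW => g • x) ⁻¹' t = (fun x => g * x) ⁻¹' t from rfl, measure_preimage_mul]⟩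
  have hΓ'le : Γ' ≤ unipDeltaRat L e dV hdV dW hdW := fun u hu => (mem_unipDeltaRat_iff L e dV hdV dW hdW u).2 ((hΓ' u).1 hu).1
  have hΓ'rat : ∀ γ ∈ Γ', ((γ : unipDelta L e dV hdV dW hdW) : HA L e dV hdV dW hdW) ∈ ratH L e dV hdV dW hdW := fun γ hγ => ((hΓ' γ).1 hγ).1
  have hΓ'P : ∀ γ ∈ Γ', IsSiegelDelta L e dV hdV dW hdW
      ((γ₀ : HA L e dV hdV dW hdW) * ((γ : unipDelta L e dV hdV dW hdW) : HA L e dV hdV dW hdW) * ((γ₀ : HA L e dV hdV dW hdW))⁻¹) :=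
    fun γ hγ => ((hΓ' γ).1 hγ).2
  haveI : Countable Γ' := (Subgroup.inclusion_injective hΓ'le).countable
  set mk : ratH L e dV hdV dW hdW → SiegelDeltaQuot L e dV hdV dW hdW :=
    Quotient.mk (MulAction.orbitRel (siegelDeltaRat L e dV hdV dW hdW) (ratH L e dV hdV dW hdW)) with hmk
  -- `ι ν := ν` seen in `H(L⁺)`; `ι (a b⁻¹) = ι a (ι b)⁻¹`
  have hιmul : ∀ a b : unipDeltaRat L e dV hdV dW hdW, (⟨(((a * b⁻¹) : unipDelta L e dV hdV dW hdW) : HA L e dV hdV dW hdW), coe_mem_ratH (a * b⁻¹)⟩ : ratH L e dV hdV dW hdW) = (⟨(((a) : unipDelta L e dV hdV dW hdW) : HA L e dV hdV dW hdW), coe_mem_ratH (a)⟩ : ratH L e dV hdV dW hdW) * ((⟨(((b) : unipDelta L e dV hdV dW hdW) : HA L e dV hdV dW hdW), coe_mem_ratH (b)⟩ : ratH L e dV hdV dW hdW))⁻¹ := fun a b => rfl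
  -- `[γ₀ a] = [γ₀ b] ⟺ a b⁻¹ ∈ Γ'`
  have hstab : ∀ a b : unipDeltaRat L e dV hdV dW hdW, mk (γ₀ * (⟨(((a) : unipDelta L e dV hdV dW hdW) : HA L e dV hdV dW hdW), coe_mem_ratH (a)⟩ : ratH L e dV hdV dW hdW)) = mk (γ₀ * (⟨(((b) : unipDelta L e dV hdV dW hdW) : HA L e dV hdV dW hdW), coe_mem_ratH (b)⟩ : ratH L e dV hdV dW hdW)) →
      (a : unipDelta L e dV hdV dW hdW) * (b : unipDelta L e dV hdV dW hdW)⁻¹ ∈ Γ' := by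
    intro a b hab
    have hab' : mk (γ₀ * (⟨(((a * b⁻¹) : unipDelta L e dV hdV dW hdW) : HA L e dV hdV dW hdW), coe_mem_ratH (a * b⁻¹)⟩ : ratH L e dV hdV dW hdW)) = mk γ₀ := by
      rw [hιmul]; exact (mk_mul_eq_mk_mul_iff γ₀ _ _).1 hab
    exact (hΓ' _).2 ⟨(mem_unipDeltaRat_iff L e dV hdV dW hdW _).1 (a * b⁻¹).2, (mk_mul_coe_eq_mk_iff γ₀ (a * b⁻¹)).1 hab'⟩
  have hstab' : ∀ a b : unipDeltaRat L e dV hdV dW hdW, (a : unipDelta L e dV hdV dW hdW) * (b : unipDelta L e dV hdV dW hdW)⁻¹ ∈ Γ' →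
      mk (γ₀ * (⟨(((a) : unipDelta L e dV hdV dW hdW) : HA L e dV hdV dW hdW), coe_mem_ratH (a)⟩ : ratH L e dV hdV dW hdW)) = mk (γ₀ * (⟨(((b) : unipDelta L e dV hdV dW hdW) : HA L e dV hdV dW hdW), coe_mem_ratH (b)⟩ : ratH L e dV hdV dW hdW)) := by
    intro a b hab
    have hab' : mk (γ₀ * (⟨(((a * b⁻¹) : unipDelta L e dV hdV dW hdW) : HA L e dV hdV dW hdW), coe_mem_ratH (a * b⁻¹)⟩ : ratH L e dV hdV dW hdW)) = mk γ₀ := (mk_mul_coe_eq_mk_iff γ₀ (a * b⁻¹)).2 ((hΓ' _).1 hab).2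
    rw [hιmul] at hab'
    exact (mk_mul_eq_mk_mul_iff γ₀ _ _).2 hab'
  -- the section `q ↦ ν q`, `[γ₀ ν_q] = q`
  have hsec : ∀ q : ↥(Set.range (fun ν : unipDeltaRat L e dV hdV dW hdW => mk (γ₀ * (⟨(((ν) : unipDelta L e dV hdV dW hdW) : HA L e dV hdV dW hdW), coe_mem_ratH (ν)⟩ : ratH L e dV hdV dW hdW)))),
      ∃ ν₁ : unipDeltaRat L e dV hdV dW hdW, mk (γ₀ * (⟨(((ν₁) : unipDelta L e dV hdV dW hdW) : HA L e dV hdV dW hdW), coe_mem_ratH (ν₁)⟩ : ratH L e dV hdV dW hdW)) = q.1 := fun q => q.2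
  choose ν hνq using hsec
  have hν : ∀ γ ∈ unipDeltaRat L e dV hdV dW hdW, ∃! i, γ * ((ν i : unipDelta L e dV hdV dW hdW))⁻¹ ∈ Γ' := by
    intro γ hγ
    refine ⟨⟨mk (γ₀ * (⟨((((⟨γ, hγ⟩ : unipDeltaRat L e dV hdV dW hdW)) : unipDelta L e dV hdV dW hdW) : HA L e dV hdV dW hdW), coe_mem_ratH ((⟨γ, hγ⟩ : unipDeltaRat L e dV hdV dW hdW))⟩ : ratH L e dV hdV dW hdW)), ⟨γ, hγ⟩, rfl⟩, hstab ⟨γ, hγ⟩ _ (by rw [hνq]), fun j hj => Subtype.ext ?_⟩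
    rw [← hνq j]
    exact (hstab' ⟨γ, hγ⟩ _ hj).symm
  -- integrand identification `f(γ_q x) = f(γ₀ ν_q x)`
  have hout : ∀ (q : ↥(Set.range (fun ν : unipDeltaRat L e dV hdV dW hdW => mk (γ₀ * (⟨(((ν) : unipDelta L e dV hdV dW hdW) : HA L e dV hdV dW hdW), coe_mem_ratH (ν)⟩ : ratH L e dV hdV dW hdW))))) (x : HA L e dV hdV dW hdW),
      f (((Quotient.out q.1 : ratH L e dV hdV dW hdW) : HA L e dV hdV dW hdW) * x) =
        f ((γ₀ : HA L e dV hdV dW hdW) * (((ν q : unipDelta L e dV hdV dW hdW)) : HA L e dV hdV dW hdW) * x) := by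
    intro q x
    rw [← apply_out_orbit hf γ₀ (ν q) x]
    congr 4
    exact (hνq q).symm
  have hO' : ∫⁻ u, (∑' i, ‖f ((γ₀ : HA L e dV hdV dW hdW) * (((ν i : unipDelta L e dV hdV dW hdW)) : HA L e dV hdV dW hdW) *
      ((u : HA L e dV hdV dW hdW) * h))‖ₑ) * β u ∂νN ≠ ∞ := by
    simp only [hout] at hO
    exact hO
  -- Tonelli unfolding: `∫⁻ ‖f(γ₀ u h)‖ₑ β₁ = ∫⁻ (Σ'_i ‖f(γ₀ ν_i u h)‖ₑ) β`
  have hFn : Measurable fun u : unipDelta L e dV hdV dW hdW => ‖f ((γ₀ : HA L e dV hdV dW hdW) * (u : HA L e dV hdV dW hdW) * h)‖ₑ :=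
    measurable_enorm_apply_mul_coe_mul hfc _ h
  have hFninv : ∀ γ ∈ Γ', ∀ u : unipDelta L e dV hdV dW hdW,
      ‖f ((γ₀ : HA L e dV hdV dW hdW) * (((γ • u : unipDelta L e dV hdV dW hdW)) : HA L e dV hdV dW hdW) * h)‖ₑ =
        ‖f ((γ₀ : HA L e dV hdV dW hdW) * (u : HA L e dV hdV dW hdW) * h)‖ₑ := fun γ hγ u => by
    rw [smul_eq_mul, apply_translate_subgroup_mul hf γ₀ h Γ' hΓ'rat hΓ'P hγ u]
  rw [lintegral_mul_eq_lintegral_tsum_mul νN (unipDeltaRat L e dV hdV dW hdW) Γ' hΓ'le hFn hFninv hβ₁.1 hβ₁.2 hβ.1 hβ.2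
    (s := fun i => (ν i : unipDelta L e dV hdV dW hdW)) (fun i => (ν i).2) hν]
  refine ne_of_eq_of_ne ?_ hO'
  refine lintegral_congr fun u => ?_
  congr 1
  refine tsum_congr fun i => ?_
  rw [smul_eq_mul, Subgroup.coe_mul, ← mul_assoc, ← mul_assoc]


omit [MeasurableSpace (unipDelta L e dV hdV dW hdW)] [BorelSpace (unipDelta L e dV hdV dW hdW)] in
/-- **the conjugation automorphism of `N_Δ(𝔸)` by an element normalising it** (e.g. `Λ(x)`, α2c `conj_levi_mem_unipDelta`), as a `MulEquiv` with its
values. [cite: MoeglinWaldspurger1995, I.2.1] -/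
theorem exists_conj_mulEquiv (p : HA L e dV hdV dW hdW) (hp : ∀ u : HA L e dV hdV dW hdW, u ∈ unipDelta L e dV hdV dW hdW → p * u * p⁻¹ ∈ unipDelta L e dV hdV dW hdW)
    (hp' : ∀ u : HA L e dV hdV dW hdW, u ∈ unipDelta L e dV hdV dW hdW → p⁻¹ * u * p ∈ unipDelta L e dV hdV dW hdW) :
    ∃ φ : unipDelta L e dV hdV dW hdW ≃* unipDelta L e dV hdV dW hdW, (∀ u : unipDelta L e dV hdV dW hdW, ((φ u : unipDelta L e dV hdV dW hdW) : HA L e dV hdV dW hdW) = p * (u : HA L e dV hdV dW hdW) * p⁻¹) ∧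
      ∀ u : unipDelta L e dV hdV dW hdW, ((φ.symm u : unipDelta L e dV hdV dW hdW) : HA L e dV hdV dW hdW) = p⁻¹ * (u : HA L e dV hdV dW hdW) * p :=
  ⟨{ toFun := fun u => ⟨p * (u : HA L e dV hdV dW hdW) * p⁻¹, hp _ u.2⟩,
     invFun := fun u => ⟨p⁻¹ * (u : HA L e dV hdV dW hdW) * p, hp' _ u.2⟩,
     left_inv := fun u => Subtype.ext (by
       show p⁻¹ * (p * (u : HA L e dV hdV dW hdW) * p⁻¹) * p = u
       simp only [mul_assoc, inv_mul_cancel_left, inv_mul_cancel, mul_one]),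
     right_inv := fun u => Subtype.ext (by
       show p * (p⁻¹ * (u : HA L e dV hdV dW hdW) * p) * p⁻¹ = u
       simp only [mul_assoc, mul_inv_cancel_left, mul_inv_cancel, mul_one]),
     map_mul' := fun u v => Subtype.ext (by
       show p * ((u : HA L e dV hdV dW hdW) * (v : HA L e dV hdV dW hdW)) * p⁻¹ = p * (u : HA L e dV hdV dW hdW) * p⁻¹ * (p * (v : HA L e dV hdV dW hdW) * p⁻¹)
       simp only [mul_assoc, inv_mul_cancel_left]) }, fun _ => rfl, fun _ => rfl⟩

/-- **Fubini for series under (H), on any set of cosets**: `∫ β(u) • Σ_{q ∈ R} f(γ_q u h) dνN = Σ_{q ∈ R} ∫ β(u) • f(γ_q u h) dνN` (`MeasureTheory.integral_tsum`;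
the absolute-convergence hypothesis (H) is `∫⁻ Σ_q ‖f(γ_q u h)‖ₑ β dνN < ∞`). [cite: MoeglinWaldspurger1995, II.1.7] [cite: Garrett2018, §3.10] -/
theorem integral_wt_smul_tsum_subtype_eq_tsum (νN : Measure (unipDelta L e dV hdV dW hdW)) [νN.IsMulLeftInvariant]
    {β : unipDelta L e dV hdV dW hdW → ℝ≥0∞} (hβ : IsCoveringWeight (unipDeltaRat L e dV hdV dW hdW) β) {f : HA L e dV hdV dW hdW → ℂ} (hfc : Continuous f) (h : HA L e dV hdV dW hdW)
    (hH : ∫⁻ u, (∑' q : SiegelDeltaQuot L e dV hdV dW hdW,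
        ‖f ((((Quotient.out q : ratH L e dV hdV dW hdW) : HA L e dV hdV dW hdW)) * ((u : HA L e dV hdV dW hdW) * h))‖ₑ) * β u ∂νN ≠ ∞)
    (R : Set (SiegelDeltaQuot L e dV hdV dW hdW)) :
    ∫ u, (β u).toReal • (∑' q : ↥R, f ((((Quotient.out (q : SiegelDeltaQuot L e dV hdV dW hdW) : ratH L e dV hdV dW hdW) : HA L e dV hdV dW hdW)) * ((u : HA L e dV hdV dW hdW) * h))) ∂νN =
      ∑' q : ↥R, ∫ u, (β u).toReal • f ((((Quotient.out (q : SiegelDeltaQuot L e dV hdV dW hdW) : ratH L e dV hdV dW hdW) : HA L e dV hdV dW hdW)) * ((u : HA L e dV hdV dW hdW) * h)) ∂νN := by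
  haveI : Countable (unipDeltaRat L e dV hdV dW hdW) := countable_unipDeltaRat L e dV hdV dW hdW
  haveI : Countable (ratH L e dV hdV dW hdW) := countable_ratH L e dV hdV dW hdW
  haveI : Countable (SiegelDeltaQuot L e dV hdV dW hdW) := by unfold SiegelDeltaQuot; exact inferInstance
  have hgm : ∀ q : SiegelDeltaQuot L e dV hdV dW hdW, AEStronglyMeasurable (fun u : unipDelta L e dV hdV dW hdW =>
      (β u).toReal • f ((((Quotient.out q : ratH L e dV hdV dW hdW) : HA L e dV hdV dW hdW)) * ((u : HA L e dV hdV dW hdW) * h))) νN :=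
    fun q => aestronglyMeasurable_wt_smul_apply νN hβ.1 hfc _ h
  have hsum : ∑' q : SiegelDeltaQuot L e dV hdV dW hdW, ∫⁻ u, ‖(β u).toReal •
      f ((((Quotient.out q : ratH L e dV hdV dW hdW) : HA L e dV hdV dW hdW)) * ((u : HA L e dV hdV dW hdW) * h))‖ₑ ∂νN ≠ ∞ := by
    simp_rw [enorm_wt_smul hβ]
    rw [← lintegral_tsum (f := fun (q : SiegelDeltaQuot L e dV hdV dW hdW) (u : unipDelta L e dV hdV dW hdW) =>
        ‖f ((((Quotient.out q : ratH L e dV hdV dW hdW) : HA L e dV hdV dW hdW)) * ((u : HA L e dV hdV dW hdW) * h))‖ₑ * β u)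
      fun q => ((measurable_enorm_apply_mul_coe_mul' hfc _ h).mul hβ.1).aemeasurable]
    simp_rw [ENNReal.tsum_mul_right]
    exact hH
  have hsumR : ∑' q : ↥R, ∫⁻ u, ‖(β u).toReal •
      f ((((Quotient.out (q : SiegelDeltaQuot L e dV hdV dW hdW) : ratH L e dV hdV dW hdW) : HA L e dV hdV dW hdW)) * ((u : HA L e dV hdV dW hdW) * h))‖ₑ ∂νN ≠ ∞ :=
    ne_top_of_le_ne_top hsum (ENNReal.tsum_comp_le_tsum_of_injective Subtype.val_injective _)
  rw [← integral_tsum (fun q : ↥R => hgm q) hsumR]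
  refine integral_congr_ae (ae_of_all _ fun u => ?_)
  show (β u).toReal • (∑' q : ↥R, f ((((Quotient.out (q : SiegelDeltaQuot L e dV hdV dW hdW) : ratH L e dV hdV dW hdW) : HA L e dV hdV dW hdW)) * ((u : HA L e dV hdV dW hdW) * h))) =
    ∑' q : ↥R, (β u).toReal • f ((((Quotient.out (q : SiegelDeltaQuot L e dV hdV dW hdW) : ratH L e dV hdV dW hdW) : HA L e dV hdV dW hdW)) * ((u : HA L e dV hdV dW hdW) * h))
  rw [tsum_const_smul'' (β u).toReal]

/-- **the coset integrals `J(q) = ∫ β(u) • f(γ_q u h) dνN` are absolutely summable under (H)** (`‖J(q)‖ ≤ ∫⁻ ‖f(γ_q u h)‖ₑ β`).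
[cite: MoeglinWaldspurger1995, II.1.7] [cite: Garrett2018, §3.10] -/
theorem summable_integral_wt_smul (νN : Measure (unipDelta L e dV hdV dW hdW)) [νN.IsMulLeftInvariant]
    {β : unipDelta L e dV hdV dW hdW → ℝ≥0∞} (hβ : IsCoveringWeight (unipDeltaRat L e dV hdV dW hdW) β) {f : HA L e dV hdV dW hdW → ℂ} (hfc : Continuous f) (h : HA L e dV hdV dW hdW)
    (hH : ∫⁻ u, (∑' q : SiegelDeltaQuot L e dV hdV dW hdW,
        ‖f ((((Quotient.out q : ratH L e dV hdV dW hdW) : HA L e dV hdV dW hdW)) * ((u : HA L e dV hdV dW hdW) * h))‖ₑ) * β u ∂νN ≠ ∞) :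
    Summable (fun q : SiegelDeltaQuot L e dV hdV dW hdW => ∫ u, (β u).toReal • f ((((Quotient.out q : ratH L e dV hdV dW hdW) : HA L e dV hdV dW hdW)) * ((u : HA L e dV hdV dW hdW) * h)) ∂νN) := by
  haveI : Countable (unipDeltaRat L e dV hdV dW hdW) := countable_unipDeltaRat L e dV hdV dW hdW
  haveI : Countable (ratH L e dV hdV dW hdW) := countable_ratH L e dV hdV dW hdW
  haveI : Countable (SiegelDeltaQuot L e dV hdV dW hdW) := by unfold SiegelDeltaQuot; exact inferInstance
  have hsum : ∑' q : SiegelDeltaQuot L e dV hdV dW hdW, ∫⁻ u, ‖(β u).toReal •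
      f ((((Quotient.out q : ratH L e dV hdV dW hdW) : HA L e dV hdV dW hdW)) * ((u : HA L e dV hdV dW hdW) * h))‖ₑ ∂νN ≠ ∞ := by
    simp_rw [enorm_wt_smul hβ]
    rw [← lintegral_tsum (f := fun (q : SiegelDeltaQuot L e dV hdV dW hdW) (u : unipDelta L e dV hdV dW hdW) =>
        ‖f ((((Quotient.out q : ratH L e dV hdV dW hdW) : HA L e dV hdV dW hdW)) * ((u : HA L e dV hdV dW hdW) * h))‖ₑ * β u)
      fun q => ((measurable_enorm_apply_mul_coe_mul' hfc _ h).mul hβ.1).aemeasurable]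
    simp_rw [ENNReal.tsum_mul_right]
    exact hH
  refine Summable.of_norm_bounded (ENNReal.summable_toReal hsum) fun q => ?_
  rw [← toReal_enorm (∫ u, (β u).toReal • f ((((Quotient.out q : ratH L e dV hdV dW hdW) : HA L e dV hdV dW hdW)) * ((u : HA L e dV hdV dW hdW) * h)) ∂νN)]
  exact ENNReal.toReal_mono (ENNReal.ne_top_of_tsum_ne_top hsum q) (enorm_integral_le_lintegral_enorm _)

omit [MeasurableSpace (unipDelta L e dV hdV dW hdW)] [BorelSpace (unipDelta L e dV hdV dW hdW)] in
/-- **regrouping an absolutely convergent sum along a disjoint union** `R = ⨆_i O(i)`: `HasSum (i ↦ Σ_{x ∈ O i} J x) (Σ_{q ∈ R} J q)`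
(Mathlib `Set.unionEqSigmaOfDisjoint`, `Summable.tsum_sigma'`). [folklore] -/
theorem hasSum_tsum_subtype_of_eq_iUnion {α ι : Type*} {J : α → ℂ} (hJ : Summable J) {R : Set α} {O : ι → Set α}
    (hRO : R = ⋃ i, O i) (hdisj : Pairwise (Disjoint on O)) :
    HasSum (fun i => ∑' x : ↥(O i), J x) (∑' q : ↥R, J q) := by
  have hS1 : Summable (fun σ : Σ i, ↥(O i) => J σ.2.1) := by
    have h2 := (Equiv.summable_iff (Set.unionEqSigmaOfDisjoint hdisj).symm).2 (hJ.subtype (⋃ i, O i))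
    refine h2.congr fun σ => ?_
    simp only [Function.comp_apply, Set.coe_unionEqSigmaOfDisjoint_symm_apply]
  have htot : ∑' q : ↥R, J q = ∑' i, ∑' x : ↥(O i), J x := by
    rw [tsum_congr_set_coe J hRO, ← (Set.unionEqSigmaOfDisjoint hdisj).symm.tsum_eq (fun q : ↥(⋃ i, O i) => J q)]
    simp only [Set.coe_unionEqSigmaOfDisjoint_symm_apply]
    exact hS1.tsum_sigma' (fun i => hJ.subtype (O i))
  rw [htot]
  exact (hS1.sigma' (fun i => hJ.subtype (O i))).hasSum

end General


end Summit.HodgeConjecture.HodgeConjecture.Cruxes.HLiu418.K2LiuConstantTermMiddleCellPrelims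

end
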